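import Mathlib
import Summits.ValiantsHypothesis.ValiantsHypothesis.Theorems.GrenetZeonPolySizeQPAlgebraTopWindow
import HarnessLib

/-!
# Crux `GrenetZeon.PolySizeQPAlgebra` (stmt-ValiantsHypothesis-8064), line `vbp-slice-dealg` —
# the local Hessian bound for every type with `𝔪³ = 0` (e.g. `ℂ[x,y]/(x²,y²)`), all large `n`

Assembly of the residual-corank analysis of this hand chain for the types whose window `3 ≤ q ≤ ν - 1`
(`…OutsideWindow`, `…TopWindow`) is EMPTY, i.e. `𝔪³ = 0`:

* `rank_hess0_transl_le_of_top_point` — the top-of-window bound `2 + 2|κ|q + q²·dim range π` at a point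
  with a residually maximal minor of co-size `q`, `(ker φ)^q = 0` (transport of
  `rank_hess0_transl_le_of_top_normalForm`).
* `rank_hess0_transl_le_of_cube_zero` — **for every finite-dimensional commutative `ℂ`-algebra `R` with a
  character `φ`, `(ker φ)³ = 0`, `dim R ≥ 2`, a `ℂ`-linear projection `π` modulo `(ker φ)²`
  (`d = dim range π`), every `n` with `6n + 9d + 2 ≤ 2·dim R·n + 18`, every `λ`, every affine `n × n`
  matrix `A` and every point `p` with `det A(p) = 0` in `R`: `rank Hess λ(det A)(p) ≤ 2·dim R·n`.**

For `ℂ[x,y]/(x², y²)` — the only residual type of the rung `(n, 4)` (`…CornerFour`) — `dim R = 4`,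
`d = dim R/𝔪² = 3`, so the type-independent input `LocalHessianBound` holds for this type for all `n ≥ 6`
(taking for `π` any `ℂ`-linear projection onto a complement of `𝔪² = ℂ·xy`).  Together with the curvilinear
types (`…JetHessian`) and the square-zero types (`…SquareZeroResidue`), every local type of dimension `≤ 4`
except possibly those with `ν = 4 < dim R` (none: `ν = 4` in dimension `4` is curvilinear) now has its local
Hessian bound for large `n`; what remains of input (B) for the rung `(n,4)` is only bookkeeping (a
dimension-`≤ 4` version of `…LocalReduction`'s universal hypothesis), and input (A) (a good `5`-space,
threshold `8n`).  HONEST FRAMING: rank theorems; no stub of the line is closed; VP ≠ VNP is not moved.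

References: T. Mignon, N. Ressayre, IMRN 2004:79, §2 [MignonRessayre2004].
-/

noncomputable section

open MvPolynomial Matrix
open Literature.Computability.AlgebraicComplexity

-- single-conjunct layout `Summits/ValiantsHypothesis/ValiantsHypothesis`: duplicated namespace by design
set_option linter.dupNamespace false

namespace Summit.ValiantsHypothesis.ValiantsHypothesis.Theorems.GrenetZeonPolySizeQPAlgebra

section TopPoint

variable {ι κ m σ : Type*} [Fintype ι] [DecidableEq ι] [Fintype κ] [DecidableEq κ] [Fintype m]
  [DecidableEq m] [Fintype σ] [DecidableEq σ] {R : Type*} [CommRing R] [Algebra ℂ R] [Module.Finite ℂ R]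

/-- **Top of the window at a point.**  For a character `φ` with `(ker φ)^{|m|} = 0`, a `ℂ`-linear `π` with
`x - π x ∈ (ker φ)²`, `F = λ(det A)` with `A` affine, and a point `p` with a residually maximal minor of
co-size `|m| ≥ 3`: `rank Hess F(p) ≤ 2 + 2·|κ|·|m| + |m|²·dim range π`. [cite: MignonRessayre2004, §2] -/
theorem rank_hess0_transl_le_of_top_point (φ : R →ₐ[ℂ] ℂ)
    (hker : RingHom.ker (φ : R →+* ℂ) ^ Fintype.card m = ⊥) (π : R →ₗ[ℂ] R)
    (hπ : ∀ x, x - π x ∈ RingHom.ker (φ : R →+* ℂ) ^ 2) (l : R →ₗ[ℂ] ℂ)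
    (A : Matrix ι ι (MvPolynomial σ R)) (F : MvPolynomial σ ℂ) (hA : ∀ a b, (A a b).totalDegree ≤ 1)
    (hF : ∀ d, l (coeff d A.det) = coeff d F) (p : σ → ℂ) (r c : κ → ι)
    (hu : φ ((A.map (eval fun i => algebraMap ℂ R (p i))).submatrix r c).det ≠ 0)
    (hmax : ∀ a b : ι, φ ((A.map (eval fun i => algebraMap ℂ R (p i))).submatrix
      (Sum.elim r fun _ : Unit => a) (Sum.elim c fun _ : Unit => b)).det = 0)
    (hcard : Fintype.card ι = Fintype.card κ + Fintype.card m) (hm3 : 3 ≤ Fintype.card m) :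
    (hess0 (transl p F)).rank ≤ 2 + 2 * Fintype.card κ * Fintype.card m +
      Fintype.card m * Fintype.card m * Module.finrank ℂ (LinearMap.range π) :=
  rank_hess0_transl_le_of_maximal_minor (m := m) φ hker l A F hA hF p r c hu hmax hcard
    fun l' A' S hA' hF' hB' hS' =>
      rank_hess0_transl_le_of_top_normalForm φ hker l' A' F hA' hF' p S hB' hS' hm3 π hπ

end TopPoint

/-! ### Types with `𝔪³ = 0`: the local Hessian bound at every point, for all large `n` -/

section CubeZero

variable {σ : Type*} [Fintype σ] [DecidableEq σ] {R : Type*} [CommRing R] [Algebra ℂ R] [Module.Finite ℂ R]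

/-- **`LocalHessianBound` for every local type with `𝔪³ = 0`, above an explicit threshold in `n`.**  Let
`R` be a finite-dimensional commutative `ℂ`-algebra with a character `φ`, `(ker φ)³ = 0`, `dim_ℂ R ≥ 2`, and
`π : R → R` a `ℂ`-linear map with `x - π x ∈ (ker φ)²` (a projection modulo `𝔪²`; `d = dim range π`).
For every functional `λ`, every affine `n × n` matrix `A` with read-out `F = λ(det A)`, every `n` with
`6n + 9d + 2 ≤ 2·dim R·n + 18`, and every point `p` with `det A(p) = 0` in `R`:
`rank Hess F(p) ≤ 2 · dim_ℂ R · n`.  (Residual corank `≤ 2` or `≥ 4`: `…OutsideWindow`; `= 3`: the top of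
the window.)  Instances: `ℂ[x,y]/(x², y²)` — the residual type of the rung `(n, 4)` (`dim R = 4`, `d = 3`,
`n ≥ 6`); `ℂ[x,y]/(x,y)³`, `ℂ[x,y,z]/(x,y,z)²·…`; all square-zero types. [cite: MignonRessayre2004, §2] -/
theorem rank_hess0_transl_le_of_cube_zero {n : ℕ} (φ : R →ₐ[ℂ] ℂ)
    (hker : RingHom.ker (φ : R →+* ℂ) ^ 3 = ⊥) (hR : 2 ≤ Module.finrank ℂ R) (π : R →ₗ[ℂ] R)
    (hπ : ∀ x, x - π x ∈ RingHom.ker (φ : R →+* ℂ) ^ 2)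
    (hn : 6 * n + 9 * Module.finrank ℂ (LinearMap.range π) + 2 ≤ 2 * Module.finrank ℂ R * n + 18)
    (l : R →ₗ[ℂ] ℂ) (A : Matrix (Fin n) (Fin n) (MvPolynomial σ R)) (F : MvPolynomial σ ℂ)
    (hA : ∀ a b, (A a b).totalDegree ≤ 1) (hF : ∀ d, l (coeff d A.det) = coeff d F) (p : σ → ℂ)
    (hp : eval (fun i => algebraMap ℂ R (p i)) A.det = 0) :
    (hess0 (transl p F)).rank ≤ 2 * Module.finrank ℂ R * n := by
  classical
  haveI : Nontrivial R := RingHom.domain_nontrivial (φ : R →+* ℂ)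
  set B : Matrix (Fin n) (Fin n) R := A.map (eval fun i => algebraMap ℂ R (p i)) with hB
  obtain ⟨k, r, c, hu, hmax⟩ := exists_maximal_residual_minor (φ : R →+* ℂ) B
  have hr : Function.Injective r := by
    intro i j hij
    by_contra hne
    apply hu
    rw [Matrix.det_zero_of_row_eq hne (funext fun l => by simp only [Matrix.submatrix_apply, hij]),
      map_zero]
  have hkn : k ≤ n := by simpa using Fintype.card_le_of_injective r hr
  by_cases hq3 : n = k + 3
  · -- residual corank `3`: the top of the window
    have h := rank_hess0_transl_le_of_top_point (m := Fin 3) φ (by simpa only [Fintype.card_fin] using hker)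
      π hπ l A F hA hF p r c hu hmax (by simp only [Fintype.card_fin]; omega) (by simp)
    simp only [Fintype.card_fin] at h
    have hk : k = n - 3 := by omega
    subst hk
    have h6 : 2 + 2 * (n - 3) * 3 + 3 * 3 * Module.finrank ℂ (LinearMap.range π) ≤
        2 * Module.finrank ℂ R * n := by
      have : 2 * (n - 3) * 3 = 6 * n - 18 := by omega
      omega
    exact h.trans h6
  · exact rank_hess0_transl_le_outside_window φ hker (by omega) l A F hA hF p hp r c hu hmax (by omega)

end CubeZero

end Summit.ValiantsHypothesis.ValiantsHypothesis.Theorems.GrenetZeonPolySizeQPAlgebra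

end
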